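import Summits.ResolutionOfSingularities.ResolutionOfSingularities.Theorems.FrobeniusLadderFInjectiveMacaulayficationNonFullCentreComap
import Summits.ResolutionOfSingularities.ResolutionOfSingularities.Theorems.FrobeniusLadderFInjectiveMacaulayficationTowerPersistenceKit
import Summits.ResolutionOfSingularities.ResolutionOfSingularities.Theorems.FrobeniusLadderFInjectiveMacaulayficationRadTauLoopGlobal
import HarnessLib

/-!
# The chain's finitistic test ideal is invariant under ring isomorphisms; the non-F-regular locus pulls back along flat preimmersions;
# ★ the rad-τ recipe `tauCentre` IS LOCAL (the hypothesis `hloc` of p642899 / p645306, DISCHARGED) and satisfies (T1) along flat preimmersions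
# (crux `FInjectiveMacaulayfication` stmt-ResolutionOfSingularities-15315, chain w45a; res-L1-w45a-plan-1 R21.3 (3) queue item Q5 «(L-f) τ-twin of (T1)», LOW; seat res-L1-w45a-lead-1 g10)

[OURS · L1 W4.5a] Support file (`--supports stmt-ResolutionOfSingularities-15315 --as helper`); def-free, fact-free, UNCONDITIONAL. Nothing of the crux is proved; no route
item is touched (`TauTowerConjecture` is OUR OWN candidate, refuted BY EVIDENCE R19.16; its kernel record p642899/p645306 stays conditional on the test-ideal
IDENTIFICATIONS `hτL`/`hτM`, which this file does not supply). AI-written (AI review is weaker than expert review).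

* §1 along a ring isomorphism `e : A ≃+* B`: `minimalPrimes_eq_image_comap`, `map_mem_minimalPrimesCompl_iff` (`R°` is transported), `map_frobeniusPower`
  (`I^[q]` is transported), `map_tightClosure'` (the chain's instance-free tight closure `IntrinsicTower.Recipes.tightClosure'` is transported),
  ★ `comap_testIdeal'` / `testIdeal'_eq_top_iff` (the chain's test ideal `IntrinsicTower.Recipes.testIdeal' p` is transported; in particular «`τ = (1)`» is
  invariant) — plain transport of structure, written out because the three definitions are bespoke.
* §2 schemes: `mem_nonFRegLocus_iff_of_isIso_stalkMap`, `preimage_nonFRegLocus` (flat preimmersions, e.g. open immersions and `T ×_X Spec 𝒪_{X,v} ⟶ T`).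
* §3 ★ `tauCentreLiteral_local` / `tauCentre_local : (tauCentre p S).comap j = tauCentre p U` for every open immersion `j : U ⟶ S` = the hypothesis `hloc` of
  `RadTauLoopConditional.not_exists_tauTower_of_cycle` (p642899 §3) and of `not_tauTowerConjecture_of_global_cycle_data` (p645306), now a theorem;
  ★ `tauCentre_comap` = (T1) for the rad-τ recipe along flat preimmersions whose range contains the closure of the recipe's point-locus (twin of p647370
  `nonFullCentre_comap`).
* §4 the (L-f) kernel record of the TT-τ refutation with `hloc` REMOVED (and the unused centre identifications `hτL`/`hτM` of §3 dropped):
  `not_exists_tauTower_of_cycle'` (p642899 §3 minus `hloc`) and ★ `not_tauTowerConjecture_of_global_cycle_data'` (p645306 minus `hloc`/`hτL`/`hτM`). What REMAINS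
  conditional, stated plainly: the two blowing ups `πL`, `πM` of the loop germs ALONG `tauCentre 2` receiving the other germ as an open chart (constructible from the
  coordinate-centre charts ✓ p643799 / ✓ p645661 ONLY once `tauCentre 2 U_L = (ā,c̄,d̄,ē)~` and `tauCentre 2 U_M = (ā,c̄,ē)~` are kernel theorems — test-ideal
  computations, R19.7-DEFERRED-1), the occurrence prefix `F 0 ← … ← F m ⊇° U_L`, and `hfloor` (the conjecture transported to the global floor `F 0`).
[folklore; cite: HochsterHuneke1990, §8 (test ideals; names only)] [cite: StacksProject, Tag 01J3] [cite: GortzWedhorn2020, Prop. 13.91 (2)]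
-/

-- single-problem summit: the doubled namespace component is forced
set_option linter.dupNamespace false

noncomputable section

open AlgebraicGeometry CategoryTheory CategoryTheory.Limits Literature.AlgebraicGeometry.Resolution TopologicalSpace IsLocalRing
open Literature.RingTheory.TightClosure (frobeniusPower frobeniusPower_def minimalPrimesCompl mem_minimalPrimesCompl_iff)

namespace Summit.ResolutionOfSingularities.ResolutionOfSingularities.Theorems.FInjectiveMacaulayfication.TestIdealTransport

open Summit.ResolutionOfSingularities.ResolutionOfSingularities.Theorems.FInjectiveMacaulayfication
open SliceableCentre IntrinsicTower IntrinsicTower.Recipes FullCentreDescent Scheme.IdealSheafData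

/-! ## §1 Transport of `R°`, `I^[q]`, `tightClosure'`, `testIdeal'` along a ring isomorphism -/

section Ring

variable {A B : Type} [CommRing A] [CommRing B]

/-- The minimal primes of `A` are the contractions of the minimal primes of `B` along `e : A ≃+* B`. [folklore] -/
theorem minimalPrimes_eq_image_comap (e : A ≃+* B) :
    minimalPrimes A = Ideal.comap (e : A →+* B) '' minimalPrimes B := by
  have h := Ideal.comap_minimalPrimes_eq_of_surjective (f := (e : A →+* B)) e.surjective ⊥
  rw [Ideal.comap_bot_of_injective (e : A →+* B) e.injective] at h
  exact h

/-- `R°` (elements in no minimal prime) is transported by a ring isomorphism. [folklore] -/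
theorem map_mem_minimalPrimesCompl_iff (e : A ≃+* B) (c : A) :
    e c ∈ minimalPrimesCompl B ↔ c ∈ minimalPrimesCompl A := by
  rw [mem_minimalPrimesCompl_iff, mem_minimalPrimesCompl_iff, minimalPrimes_eq_image_comap e, Set.forall_mem_image]
  simp only [Ideal.mem_comap, RingEquiv.coe_toRingHom]

/-- Frobenius powers are transported by a ring isomorphism: `e (I^[q]) = (e I)^[q]`. [folklore] -/
theorem map_frobeniusPower (e : A ≃+* B) (q : ℕ) (I : Ideal A) :
    (frobeniusPower q I).map (e : A →+* B) = frobeniusPower q (I.map (e : A →+* B)) := by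
  rw [frobeniusPower_def, frobeniusPower_def, Ideal.map_span]
  congr 1
  ext y
  constructor
  · rintro ⟨z, ⟨x, hx, rfl⟩, rfl⟩
    exact ⟨e x, (Ideal.apply_mem_of_equiv_iff).mpr hx, by simp⟩
  · rintro ⟨z, hz, rfl⟩
    obtain ⟨x, hx, rfl⟩ := (Ideal.mem_map_of_equiv e z).mp hz
    exact ⟨x ^ q, ⟨x, hx, rfl⟩, by simp⟩

/-- Membership in an ideal mapped along a ring isomorphism. [folklore] -/
theorem mem_map_equiv_iff (e : A ≃+* B) (I : Ideal A) (y : B) : y ∈ I.map (e : A →+* B) ↔ e.symm y ∈ I := by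
  rw [Ideal.map_comap_of_equiv, Ideal.mem_comap]

/-- The chain's instance-free tight closure `tightClosure'` is transported by a ring isomorphism. [folklore] -/
theorem map_tightClosure' (e : A ≃+* B) (p : ℕ) (I : Ideal A) :
    (tightClosure' p I).map (e : A →+* B) = tightClosure' p (I.map (e : A →+* B)) := by
  unfold tightClosure'
  rw [Ideal.map_span]
  congr 1
  ext y
  constructor
  · rintro ⟨x, ⟨c, hc, e₀, h⟩, rfl⟩
    refine ⟨e c, (map_mem_minimalPrimesCompl_iff e c).mpr hc, e₀, fun n hn => ?_⟩
    have h1 : (e : A →+* B) (c * x ^ p ^ n) ∈ (frobeniusPower (p ^ n) I).map (e : A →+* B) := Ideal.mem_map_of_mem _ (h n hn)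
    rw [map_frobeniusPower] at h1
    simpa using h1
  · rintro ⟨c', hc', e₀, h⟩
    refine ⟨e.symm y, ⟨e.symm c', ?_, e₀, fun n hn => ?_⟩, e.apply_symm_apply y⟩
    · rw [← map_mem_minimalPrimesCompl_iff e, e.apply_symm_apply]
      exact hc'
    · have h1 := h n hn
      rw [← map_frobeniusPower, mem_map_equiv_iff] at h1
      simpa using h1

/-- ★ The chain's finitistic TEST IDEAL `testIdeal' p` is transported by a ring isomorphism (contraction form). [folklore] -/
theorem comap_testIdeal' (e : A ≃+* B) (p : ℕ) :
    (testIdeal' p B).comap (e : A →+* B) = testIdeal' p A := by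
  ext x
  simp only [testIdeal', Ideal.mem_comap, Submodule.mem_iInf, Submodule.mem_colon, smul_eq_mul, RingEquiv.coe_toRingHom, SetLike.mem_coe]
  constructor
  · intro h I s hs
    have h1 := h (I.map (e : A →+* B)) (e s) (by rw [← map_tightClosure']; exact Ideal.mem_map_of_mem _ hs)
    rw [← map_mul, mem_map_equiv_iff] at h1
    simpa using h1
  · intro h J t ht
    have hJ : (J.comap (e : A →+* B)).map (e : A →+* B) = J := Ideal.map_comap_of_surjective _ e.surjective J
    have ht' : e.symm t ∈ tightClosure' p (J.comap (e : A →+* B)) := by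
      rw [← hJ, ← map_tightClosure', mem_map_equiv_iff] at ht
      exact ht
    have h1 := h (J.comap (e : A →+* B)) (e.symm t) ht'
    rw [Ideal.mem_comap] at h1
    simpa using h1

/-- ★ «`τ = (1)`» is invariant under ring isomorphisms. [folklore] -/
theorem testIdeal'_eq_top_iff (e : A ≃+* B) (p : ℕ) : testIdeal' p A = ⊤ ↔ testIdeal' p B = ⊤ := by
  rw [← comap_testIdeal' e p]
  constructor
  · intro h
    exact (Ideal.comap_injective_of_surjective (e : A →+* B) e.surjective) (h.trans Ideal.comap_top.symm)
  · intro h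
    rw [h, Ideal.comap_top]

end Ring

/-! ## §2 The non-F-regular locus along stalk isomorphisms and flat preimmersions -/

/-- The non-F-regular locus is detected by isomorphic stalks. [folklore] -/
theorem mem_nonFRegLocus_iff_of_isIso_stalkMap (p : ℕ) {X Y : Scheme.{0}} (π : X ⟶ Y) (x : X) [IsIso (π.stalkMap x)] :
    π.base x ∈ nonFRegLocus p Y ↔ x ∈ nonFRegLocus p X := by
  simp only [nonFRegLocus, Set.mem_setOf_eq]
  exact not_congr (testIdeal'_eq_top_iff (asIso (π.stalkMap x)).commRingCatIsoToRingEquiv p)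

/-- The non-F-regular locus pulls back along flat preimmersions (open immersions; `T ×_X Spec 𝒪_{X,v} ⟶ T`). [folklore] -/
theorem preimage_nonFRegLocus (p : ℕ) {S S' : Scheme.{0}} (f : S' ⟶ S) [Flat f] [IsPreimmersion f] :
    f.base ⁻¹' nonFRegLocus p S = nonFRegLocus p S' := by
  ext u
  rw [Set.mem_preimage]
  haveI : IsIso (f.stalkMap u) := isIso_stalkMap_of_flat_of_isPreimmersion f u
  exact mem_nonFRegLocus_iff_of_isIso_stalkMap p f u

/-- The rad-τ recipe's point-locus `(nonFRegLocus ∪ nonFullLocus) ∩ (Reg)ᶜ` pulls back along flat preimmersions. [folklore] -/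
theorem preimage_tauLocus (p : ℕ) {S S' : Scheme.{0}} (f : S' ⟶ S) [Flat f] [IsPreimmersion f] :
    f.base ⁻¹' ((nonFRegLocus p S ∪ nonFullLocus p S) ∩ (Scheme.regularLocus S)ᶜ) =
      (nonFRegLocus p S' ∪ nonFullLocus p S') ∩ (Scheme.regularLocus S')ᶜ := by
  rw [Set.preimage_inter, Set.preimage_union, preimage_nonFRegLocus p f, RecipeTowerTransfer.preimage_nonFullLocus p f,
    RecipeTowerTransfer.preimage_compl_regularLocus f]

/-! ## §3 ★ Locality of `tauCentre` and its (T1) along flat preimmersions -/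

/-- ★ **`tauCentre` IS LOCAL, literal form** (on the definition's body, so that `tauCentre p S` unfolds to it by `rfl`). [folklore] -/
theorem tauCentreLiteral_local (p : ℕ) {U S : Scheme.{0}} (j : U ⟶ S) [IsOpenImmersion j] :
    (vanishingIdeal ⟨closure ((nonFRegLocus p S ∪ nonFullLocus p S) ∩ (Scheme.regularLocus S)ᶜ), isClosed_closure⟩).comap j =
      vanishingIdeal ⟨closure ((nonFRegLocus p U ∪ nonFullLocus p U) ∩ (Scheme.regularLocus U)ᶜ), isClosed_closure⟩ :=
  comap_vanishingIdeal_closure_of_isOpenImmersion (fun S => (nonFRegLocus p S ∪ nonFullLocus p S) ∩ (Scheme.regularLocus S)ᶜ)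
    (fun j _ => preimage_tauLocus p j) j

/-- ★ **`tauCentre` IS LOCAL**: `(tauCentre p S)|_U = tauCentre p U` for every open immersion `j : U ⟶ S` — the hypothesis `hloc` of p642899 §3/§4 and p645306,
DISCHARGED. [folklore] -/
theorem tauCentre_local (p : ℕ) {U S : Scheme.{0}} (j : U ⟶ S) [IsOpenImmersion j] : (tauCentre p S).comap j = tauCentre p U :=
  tauCentreLiteral_local p j

/-- ★ **(T1) FOR THE rad-τ RECIPE**: `tauCentre` commutes with flat preimmersions whose range contains the closure of its point-locus (twin of p647370
`RecipeTowerTransfer.nonFullCentre_comap`). [OURS · folklore assembly] -/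
theorem tauCentre_comap (p : ℕ) {S S' : Scheme.{0}} (f : S' ⟶ S) [Flat f] [IsPreimmersion f]
    (hrange : closure ((nonFRegLocus p S ∪ nonFullLocus p S) ∩ (Scheme.regularLocus S)ᶜ) ⊆ Set.range f.base) :
    (tauCentre p S).comap f = tauCentre p S' := by
  have hA : (nonFRegLocus p S ∪ nonFullLocus p S) ∩ (Scheme.regularLocus S)ᶜ ⊆ Set.range f.base := fun s hs => hrange (subset_closure hs)
  change (vanishingIdeal _).comap f = vanishingIdeal _
  rw [RecipeTowerTransfer.comap_vanishingIdeal_of_flat_preimmersion]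
  congr 1
  ext1
  rw [Closeds.coe_preimage]
  change f.base ⁻¹' closure ((nonFRegLocus p S ∪ nonFullLocus p S) ∩ (Scheme.regularLocus S)ᶜ) =
    closure ((nonFRegLocus p S' ∪ nonFullLocus p S') ∩ (Scheme.regularLocus S')ᶜ)
  rw [RecipeTowerTransfer.preimage_closure_of_subset_range f _ hA, preimage_tauLocus p f]

/-- (T1) for the rad-τ recipe in the weaker-hypothesis form «the singular locus' closure lies in the range» (the recipe's point-locus is part of the singular
locus by definition). [OURS] -/
theorem tauCentre_comap_of_sing (p : ℕ) {S S' : Scheme.{0}} (f : S' ⟶ S) [Flat f] [IsPreimmersion f]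
    (hrange : closure ((Scheme.regularLocus S)ᶜ) ⊆ Set.range f.base) : (tauCentre p S).comap f = tauCentre p S' :=
  tauCentre_comap p f ((closure_mono Set.inter_subset_right).trans hrange)

end Summit.ResolutionOfSingularities.ResolutionOfSingularities.Theorems.FInjectiveMacaulayfication.TestIdealTransport

/-! ## §4 The (L-f) kernel record without `hloc` -/

namespace Summit.ResolutionOfSingularities.ResolutionOfSingularities.Theorems.FInjectiveMacaulayfication.RadTauLoopConditional

open Summit.ResolutionOfSingularities.ResolutionOfSingularities.Theorems.FInjectiveMacaulayfication
open SliceableCentre IntrinsicTower IntrinsicTower.Recipes FullCentreDescent MvPolynomial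

/-- ★ p642899 §3 WITHOUT `hloc` (now `TestIdealTransport.tauCentre_local`) and without the unused identifications `hτL`/`hτM`: a rad-τ blowing up of `U_L` containing an
open copy of `U_M` and one of `U_M` containing an open copy of `U_L` forbid a terminating rad-τ tower on every scheme containing an open copy of `U_L`.
[OURS · CONDITIONAL on the two certified blowing ups] -/
theorem not_exists_tauTower_of_cycle' (k : Type) [Field k] [CharP k 2] (L M : MvPolynomial (Fin 5) k)
    (hL : L = X 4 ^ 2 + X 0 ^ 2 * X 2 * X 4 + X 0 * X 2 ^ 2 + X 0 * X 2 * X 3 ^ 2 + X 0 * X 1 ^ 3 * X 2 ^ 2)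
    (hM : M = X 4 ^ 2 + X 0 ^ 2 * X 2 * X 4 + X 0 * X 2 ^ 2 + X 0 ^ 2 * X 2 * X 3 ^ 2 + X 0 * X 1 ^ 3 * X 2 ^ 2)
    (BL : Scheme.{0}) (πL : BL ⟶ Spec (.of (MvPolynomial (Fin 5) k ⧸ Ideal.span {L})))
    (hπL : IsBlowup πL (tauCentre 2 (Spec (.of (MvPolynomial (Fin 5) k ⧸ Ideal.span {L})))))
    (jM : Spec (.of (MvPolynomial (Fin 5) k ⧸ Ideal.span {M})) ⟶ BL) [IsOpenImmersion jM]
    (BM : Scheme.{0}) (πM : BM ⟶ Spec (.of (MvPolynomial (Fin 5) k ⧸ Ideal.span {M})))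
    (hπM : IsBlowup πM (tauCentre 2 (Spec (.of (MvPolynomial (Fin 5) k ⧸ Ideal.span {M})))))
    (jL : Spec (.of (MvPolynomial (Fin 5) k ⧸ Ideal.span {L})) ⟶ BM) [IsOpenImmersion jL]
    (S : Scheme.{0}) (hS : ∃ j : Spec (.of (MvPolynomial (Fin 5) k ⧸ Ideal.span {L})) ⟶ S, IsOpenImmersion j) :
    ¬ ∃ n : ℕ, RecipeTowerFull tauCentre 2 n S := by
  -- the Bool-indexed cycle: `false ↦ U_L`, `true ↦ U_M` (proof text of p642899 §3 with `hloc := tauCentre_local`)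
  let U : Bool → Scheme.{0} := fun b => Bool.rec (Spec (.of (MvPolynomial (Fin 5) k ⧸ Ideal.span {L}))) (Spec (.of (MvPolynomial (Fin 5) k ⧸ Ideal.span {M}))) b
  let B : Bool → Scheme.{0} := fun b => Bool.rec BL BM b
  let π : ∀ b : Bool, B b ⟶ U b := fun b => match b with
    | false => πL
    | true => πM
  have hπ : ∀ b : Bool, IsBlowup (π b) (tauCentre 2 (U b)) := fun b => match b with
    | false => hπL
    | true => hπM
  let j : ∀ b : Bool, U (!b) ⟶ B b := fun b => match b with
    | false => jM
    | true => jL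
  have hj : ∀ b : Bool, IsOpenImmersion (j b) := fun b => match b with
    | false => show IsOpenImmersion jM from inferInstance
    | true => show IsOpenImmersion jL from inferInstance
  have hU : ∀ b : Bool, ∃ u : U b, ¬ FullCl 2 ((U b).presheaf.stalk u) := fun b => match b with
    | false => exists_not_fullCl_of_fedder_mem k L (L_ne_zero k L hL) (constantCoeff_L k L hL) (L_mem_bracket k L hL)
    | true => exists_not_fullCl_of_fedder_mem k M (M_ne_zero k M hM) (constantCoeff_M k M hM) (M_mem_bracket k M hM)
  exact not_exists_fullTower_of_recurrent_family₁ 2 (RecipeTowerFull tauCentre 2) (tauCentre 2) (fun _ h => h) (fun _ _ h => h)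
    (fun j' _ => TestIdealTransport.tauCentre_local 2 j') U hU Bool.not B π hπ j hj S (by obtain ⟨j₀, hj₀⟩ := hS; exact ⟨false, j₀, hj₀⟩)

/-- ★ **THE (L-f) KERNEL RECORD OF THE TT-τ REFUTATION, `hloc`-FREE** (p645306 minus `hloc`, `hτL`, `hτM`): given the two certified rad-τ blowing ups of the loop germs
(each receiving the other germ as an open chart), an occurrence prefix of rad-τ blowing ups `F 0 ← … ← F m` with a non-FULL point on every floor and `U_L ⊆° F m`, and the
conjecture transported to `F 0`, `TauTowerConjecture` is false. Honest status: CONDITIONAL — the certified blowing ups need the test-ideal identifications of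
`tauCentre 2` on `U_L`, `U_M` (R19.7-DEFERRED-1); the conjecture is refuted BY EVIDENCE only (R19.16). [OURS · CONDITIONAL on the named data] -/
theorem not_tauTowerConjecture_of_global_cycle_data' (k : Type) [Field k] [CharP k 2] (L M : MvPolynomial (Fin 5) k)
    (hL : L = X 4 ^ 2 + X 0 ^ 2 * X 2 * X 4 + X 0 * X 2 ^ 2 + X 0 * X 2 * X 3 ^ 2 + X 0 * X 1 ^ 3 * X 2 ^ 2)
    (hM : M = X 4 ^ 2 + X 0 ^ 2 * X 2 * X 4 + X 0 * X 2 ^ 2 + X 0 ^ 2 * X 2 * X 3 ^ 2 + X 0 * X 1 ^ 3 * X 2 ^ 2)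
    (BL : Scheme.{0}) (πL : BL ⟶ Spec (.of (MvPolynomial (Fin 5) k ⧸ Ideal.span {L})))
    (hπL : IsBlowup πL (tauCentre 2 (Spec (.of (MvPolynomial (Fin 5) k ⧸ Ideal.span {L})))))
    (jM : Spec (.of (MvPolynomial (Fin 5) k ⧸ Ideal.span {M})) ⟶ BL) [IsOpenImmersion jM]
    (BM : Scheme.{0}) (πM : BM ⟶ Spec (.of (MvPolynomial (Fin 5) k ⧸ Ideal.span {M})))
    (hπM : IsBlowup πM (tauCentre 2 (Spec (.of (MvPolynomial (Fin 5) k ⧸ Ideal.span {M})))))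
    (jL : Spec (.of (MvPolynomial (Fin 5) k ⧸ Ideal.span {L})) ⟶ BM) [IsOpenImmersion jL]
    (m : ℕ) (F : ℕ → Scheme.{0}) (g' : ∀ i : ℕ, F (i + 1) ⟶ F i)
    (hfloor : TauTowerConjecture → ∃ n : ℕ, RecipeTowerFull tauCentre 2 n (F 0))
    (hg' : ∀ i, i < m → IsBlowup (g' i) (tauCentre 2 (F i)))
    (hbad : ∀ i, i < m → ∃ s : F i, ¬ FullCl 2 ((F i).presheaf.stalk s))
    (hocc : ∃ j : Spec (.of (MvPolynomial (Fin 5) k ⧸ Ideal.span {L})) ⟶ F m, IsOpenImmersion j) :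
    ¬ TauTowerConjecture := by
  intro hTT
  have hend : ¬ ∃ n : ℕ, RecipeTowerFull tauCentre 2 n (F m) := not_exists_tauTower_of_cycle' k L M hL hM BL πL hπL jM BM πM hπM jL (F m) hocc
  exact not_exists_tower_of_bad_prefix (fun S s => FullCl 2 (S.presheaf.stalk s)) (RecipeTowerFull tauCentre 2) (tauCentre 2)
    (fun _ h => h) (fun _ _ h => h) m F g' hg' hbad hend (hfloor hTT)

end Summit.ResolutionOfSingularities.ResolutionOfSingularities.Theorems.FInjectiveMacaulayfication.RadTauLoopConditional

end
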